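import Literature.AlgebraicGeometry.HodgeTheory.GenericComplexPointsOverCountableFields
import Literature.AlgebraicGeometry.HodgeTheory.AlgebraicityLocusProofs
import Literature.AlgebraicGeometry.Motives.AbelianVarietyKernelDimension
import Mathlib.AlgebraicGeometry.Morphisms.FlatDescent
import HarnessLib

/-!
# Over a countable field, the non-generic complex points of a curve form a countable set

Topic `Literature/AlgebraicGeometry/HodgeTheory` (family `hodge`). Theorems only (no definition, no
named fact). A sequel of `GenericComplexPointsOverCountableFields.lean` (Weil-generic ⟺ over the
generic point; Charles–Schnell, *Notes on absolute Hodge classes*, Lemma 11.3.14; Lang,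
*Introduction to Algebraic Geometry*, III §5): for a field `K` embedded by `σ : K →+* ℂ` and a
`K`-scheme `S₀` locally of finite type, with complexification `S = S₀ ⊗_σ ℂ`,

* `finite_setOf_base_pt_eq` — **over a CLOSED point `x ∈ S₀` lie only finitely many complex points
  of `S`**: such a point is `Spec ℂ → Spec κ(x) → S₀` for a `K`-embedding `κ(x) → ℂ`, and `κ(x)` is
  a finite extension of `K` (Nullstellensatz), which has finitely many `K`-embeddings into `ℂ`;
* `isClosed_singleton_of_ne_genericPoint` — in an irreducible scheme of dimension `≤ 1` every point
  other than the generic point is closed;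
* `countable_setOf_base_pt_ne_genericPoint` — hence, **for `K` countable and `S₀` quasi-compact
  irreducible of dimension `≤ 1`, the complex points of `S` NOT lying over the generic point of `S₀`
  form a countable set** (`S₀` has countably many points, `countable_of_locallyOfFiniteType`);
* `countable_setOf_not_weilGeneric`, `exists_weilGeneric_of_not_countable` — the same in Weil's
  language (`IsDefinedOver σ S₀ σ.fieldRange`, the shape of `PadicDiscTransport.IsGenericPoint` of the
  crux line `padic-disc-transport` of `Summits/HodgeConjecture/HodgeConjecture/Cruxes/VariationalHodge`):
  the non-`K`-generic complex points are countable, so **every uncountable set of complex points of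
  the curve contains a `K`-generic point** — the counting step of the `p`-adic residue-disc argument
  (Maulik–Poonen 2012, §4: a residue disc is uncountable while `K̄` is countable);
* `countable_setOf_not_weilGeneric_of_complexification` — the same with the hypotheses carried by
  the complexification (`S` affine, irreducible, locally of finite type, `dim S = 1`), as in the crux.

Consumer: `HodgeTheory.exists_wittVector_points_same_reduction_generic`
(`PadicResidueDiscGenericPoint.lean`): the `q`-adic residue disc of the anchor on a smooth `W(𝔽̄_q)`-model
of the base curve is uncountable, hence contains a `K`-generic complex point.

## References

* [CharlesSchnell2014Notes] F. Charles, C. Schnell, Notes on absolute Hodge classes (2014),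
  Lemma 11.3.14.
* [Lang1958IAG] S. Lang, Introduction to Algebraic Geometry (1958), Ch. III §5.
* [MaulikPoonen2012] D. Maulik, B. Poonen, Néron–Severi groups under specialization, Duke Math.
  J. 161 (2012), §4.
* [Hartshorne1977] R. Hartshorne, Algebraic Geometry (1977), II Ex. 2.9, Ex. 3.13.
-/

noncomputable section

open CategoryTheory CategoryTheory.Limits AlgebraicGeometry Cardinal
open _root_.Topology
open Literature.AlgebraicGeometry.Motives

namespace Literature.AlgebraicGeometry.HodgeTheory

/-! ## Non-generic points of a one-dimensional irreducible scheme are closed -/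

section DimOne

/-- **In an irreducible scheme of dimension `≤ 1`, every point other than the generic point is
closed**: otherwise a proper specialisation `y` of `x` gives the chain `y < x < η` of length `2` in
the specialisation order, whose Krull dimension is the topological Krull dimension
(`irreducibleSetEquivPoints`). [cite: Hartshorne1977, Ch. II Ex. 2.9 and Ex. 3.13] -/
theorem isClosed_singleton_of_ne_genericPoint {X : Scheme} [IrreducibleSpace X]
    (hdim : topologicalKrullDim X ≤ 1) {x : X} (hx : x ≠ genericPoint X) :
    IsClosed ({x} : Set X) := by
  classical
  by_contra hxc
  -- a proper specialisation `y` of `x`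
  obtain ⟨y, hyx, hyne⟩ : ∃ y, x ⤳ y ∧ y ≠ x := by
    by_contra h
    push Not at h
    apply hxc
    have hsub : closure ({x} : Set X) ⊆ {x} := fun y hy =>
      Set.mem_singleton_iff.2 (h y (specializes_iff_mem_closure.2 hy))
    exact closure_subset_iff_isClosed.1 hsub
  have hT0 : ∀ {a b : X}, a ⤳ b → b ⤳ a → a = b := fun h h' => (h.antisymm h').eq
  have hlt₁ : y < x := lt_iff_le_not_ge.2 ⟨Scheme.le_iff_specializes.2 hyx,
    fun h' => hyne (hT0 (Scheme.le_iff_specializes.1 h') hyx)⟩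
  have hlt₂ : x < genericPoint X := lt_iff_le_not_ge.2
    ⟨Scheme.le_iff_specializes.2 (genericPoint_specializes x),
      fun h' => hx (hT0 (Scheme.le_iff_specializes.1 h') (genericPoint_specializes x))⟩
  -- the specialisation order has Krull dimension `≤ 1`
  have hkd : Order.krullDim X ≤ 1 := by
    rw [← Order.krullDim_eq_of_orderIso (irreducibleSetEquivPoints (α := X))]
    exact hdim
  have hfin : ∀ z : X, Order.height z < ⊤ := fun z => by
    have h1 : (Order.height z : WithBot ℕ∞) ≤ 1 := (Order.height_le_krullDim z).trans hkd
    have h2 : Order.height z ≤ 1 := by exact_mod_cast h1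
    exact lt_of_le_of_lt h2 (by decide)
  have h1 : Order.height y < Order.height x := Order.height_strictMono hlt₁ (hfin y)
  have h2 : Order.height x < Order.height (genericPoint X) := Order.height_strictMono hlt₂ (hfin x)
  have h3 : (1 : ℕ∞) ≤ Order.height x := by
    have := Order.add_one_le_of_lt h1
    exact le_trans (by simp) this
  have h4 : (2 : ℕ∞) ≤ Order.height (genericPoint X) := by
    have := Order.add_one_le_of_lt h2
    calc (2 : ℕ∞) = 1 + 1 := by norm_num
      _ ≤ Order.height x + 1 := by gcongr
      _ ≤ Order.height (genericPoint X) := this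
  have h5 : (Order.height (genericPoint X) : WithBot ℕ∞) ≤ 1 :=
    (Order.height_le_krullDim (genericPoint X)).trans hkd
  have h6 : Order.height (genericPoint X) ≤ 1 := by exact_mod_cast h5
  have h7 : (2 : ℕ∞) ≤ 1 := h4.trans h6
  exact absurd h7 (by decide)

end DimOne

/-! ## Complex points over a closed point of `S₀` -/

section Fibre

variable {K : Type} [Field K] (σ : K →+* ℂ) (S₀ : SchemeOver K)

/-- A complex point `s` of `S = S₀ ⊗_σ ℂ` is determined by the `K`-morphism `Spec ℂ → S₀` under it
(`s.left ≫ π`, `π : S ⟶ S₀` the projection): two sections of `S → Spec ℂ` with the same composite to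
`S₀` agree, by the universal property of the fibre product `S = S₀ ×_{Spec K} Spec ℂ`.
[cite: Hartshorne1977, Ch. II Thm. 3.3] -/
theorem ComplexPoints.ext_of_left_comp_baseChangeHomFst_eq
    {s t : ComplexPoints ((baseChangeHom σ).obj S₀)}
    (h : s.left ≫ baseChangeHomFst σ S₀ = t.left ≫ baseChangeHomFst σ S₀) : s = t := by
  ext : 1
  refine pullback.hom_ext h ?_
  have hs : s.left ≫ ((baseChangeHom σ).obj S₀).hom = (specOver ℂ ℂ).hom := Over.w s
  have ht : t.left ≫ ((baseChangeHom σ).obj S₀).hom = (specOver ℂ ℂ).hom := Over.w t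
  change s.left ≫ ((baseChangeHom σ).obj S₀).hom = t.left ≫ ((baseChangeHom σ).obj S₀).hom
  rw [hs, ht]

/-- The `K`-morphism `Spec ℂ → S₀` under a complex point of `S = S₀ ⊗_σ ℂ` lies over `σ`:
`(s ≫ π) ≫ (S₀ → Spec K) = Spec σ` (commutativity of the fibre square). [cite: Hartshorne1977, Ch. II Thm. 3.3] -/
theorem ComplexPoints.left_comp_baseChangeHomFst_comp_hom
    (s : ComplexPoints ((baseChangeHom σ).obj S₀)) :
    (s.left ≫ baseChangeHomFst σ S₀) ≫ S₀.hom = Spec.map (CommRingCat.ofHom σ) := by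
  have hs : s.left ≫ ((baseChangeHom σ).obj S₀).hom = (specOver ℂ ℂ).hom := Over.w s
  have hc : baseChangeHomFst σ S₀ ≫ S₀.hom =
      ((baseChangeHom σ).obj S₀).hom ≫ Spec.map (CommRingCat.ofHom σ) := pullback.condition
  rw [Category.assoc, hc, ← Category.assoc, hs]
  change Spec.map (CommRingCat.ofHom (algebraMap ℂ ℂ)) ≫ Spec.map (CommRingCat.ofHom σ) = _
  rw [Algebra.algebraMap_self, CommRingCat.ofHom_id, Spec.map_id, Category.id_comp]

/-- **Over a closed point of `S₀` lie only finitely many complex points of `S₀ ⊗_σ ℂ`** (`S₀` locally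
of finite type over `K`): a complex point `s` over `x` is `Spec ℂ → Spec κ(x) → S₀` for an embedding
`κ(x) → ℂ` restricting to `σ` on `K` (Mathlib `Scheme.SpecToEquivOfField`), the residue field
`κ(x)` of the closed point `x` is finite over `K` (Nullstellensatz, Mathlib
`isFinite_iff_locallyOfFiniteType_of_jacobsonSpace`), and a finite extension has finitely many
`K`-embeddings into `ℂ` (Mathlib `minpoly.AlgHom.fintype`).
[cite: Lang1958IAG, Ch. III §4 (conjugates of a point: finitely many over an algebraic point)] -/
theorem finite_setOf_base_pt_eq [LocallyOfFiniteType S₀.hom] {x : S₀.left}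
    (hx : IsClosed ({x} : Set S₀.left)) :
    {s : ComplexPoints ((baseChangeHom σ).obj S₀) |
      (baseChangeHomFst σ S₀).base s.pt = x}.Finite := by
  classical
  haveI : JacobsonSpace S₀.left := LocallyOfFiniteType.jacobsonSpace S₀.hom
  -- `Spec κ(x) → Spec K` is finite (Nullstellensatz), so `κ(x)` is a finite `K`-algebra via `φ`
  have hfin : IsFinite (S₀.left.fromSpecResidueField x ≫ S₀.hom) := by
    rw [isClosed_singleton_iff_isClosedImmersion] at hx
    rw [isFinite_iff_locallyOfFiniteType_of_jacobsonSpace]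
    infer_instance
  set φ : CommRingCat.of K ⟶ S₀.left.residueField x :=
    Spec.preimage (S₀.left.fromSpecResidueField x ≫ S₀.hom) with hφ
  have hφ' : Spec.map φ = S₀.left.fromSpecResidueField x ≫ S₀.hom := Spec.map_preimage _
  have hφfin : φ.hom.Finite := by
    rw [← IsFinite.SpecMap_iff, hφ']
    exact hfin
  letI algx : Algebra K (S₀.left.residueField x) := φ.hom.toAlgebra
  haveI : Module.Finite K (S₀.left.residueField x) := hφfin
  letI algC : Algebra K ℂ := σ.toAlgebra
  -- the finitely many candidates: `Spec ℂ → Spec κ(x) → S₀` for `K`-algebra maps `κ(x) → ℂ`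
  let cand : (S₀.left.residueField x →ₐ[K] ℂ) → (Spec (.of ℂ) ⟶ S₀.left) := fun t =>
    Spec.map (CommRingCat.ofHom t.toRingHom) ≫ S₀.left.fromSpecResidueField x
  have hcand : (Set.range cand).Finite := Set.finite_range cand
  -- the injective map `s ↦ s ≫ π`
  let G : ComplexPoints ((baseChangeHom σ).obj S₀) → (Spec (.of ℂ) ⟶ S₀.left) := fun s =>
    s.left ≫ baseChangeHomFst σ S₀
  have hG : Function.Injective G := fun s t h =>
    ComplexPoints.ext_of_left_comp_baseChangeHomFst_eq σ S₀ h
  refine (hcand.preimage hG.injOn).subset ?_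
  intro s hs
  change (baseChangeHomFst σ S₀).base s.pt = x at hs
  change G s ∈ Set.range cand
  -- write `G s = Spec.map r ≫ fromSpecResidueField y` with `y = pt`
  obtain ⟨⟨y, r⟩, hyr⟩ : ∃ yr : Σ y : S₀.left, S₀.left.residueField y ⟶ .of ℂ,
      (S₀.left.SpecToEquivOfField ℂ).symm yr = G s :=
    ⟨S₀.left.SpecToEquivOfField ℂ (G s), Equiv.symm_apply_apply _ _⟩
  have hGs : G s = Spec.map r ≫ S₀.left.fromSpecResidueField y := hyr.symm
  -- `y = x`
  have hy : y = x := by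
    have h1 : (G s).base (IsLocalRing.closedPoint ℂ) = x := hs
    rw [hGs, Scheme.Hom.comp_base, TopCat.coe_comp, Function.comp_apply,
      Scheme.fromSpecResidueField_apply] at h1
    exact h1
  subst hy
  -- `r` restricts to `σ` on `K`
  have hr : φ ≫ r = CommRingCat.ofHom σ := by
    have h1 : (G s) ≫ S₀.hom = Spec.map (CommRingCat.ofHom σ) :=
      ComplexPoints.left_comp_baseChangeHomFst_comp_hom σ S₀ s
    rw [hGs, Category.assoc, ← hφ', ← Spec.map_comp] at h1
    exact Spec.map_injective h1
  let t : S₀.left.residueField y →ₐ[K] ℂ :=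
    { toRingHom := r.hom
      commutes' := fun a => by
        change r.hom (φ.hom a) = σ a
        have := congrArg (fun f : CommRingCat.of K ⟶ CommRingCat.of ℂ => f.hom a) hr
        simpa using this }
  refine ⟨t, ?_⟩
  change Spec.map (CommRingCat.ofHom t.toRingHom) ≫ S₀.left.fromSpecResidueField y = G s
  rw [hGs]
  rfl

end Fibre

/-! ## Countability of the non-generic complex points -/

section Countable

variable {K : Type} [Field K] (σ : K →+* ℂ) (S₀ : SchemeOver K)

/-- **Over a countable field, the complex points of a quasi-compact irreducible curve `S₀ ⊗_σ ℂ`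
that do not lie over the generic point of `S₀` form a countable set**: `S₀` has countably many
points (`countable_of_locallyOfFiniteType`), every non-generic point of the one-dimensional
irreducible `S₀` is closed (`isClosed_singleton_of_ne_genericPoint`), and over each closed point lie
finitely many complex points (`finite_setOf_base_pt_eq`). [cite: MaulikPoonen2012, §4]
[cite: CharlesSchnell2014Notes, Lemma 11.3.14] -/
theorem countable_setOf_base_pt_ne_genericPoint [Countable K] [LocallyOfFiniteType S₀.hom]
    [CompactSpace S₀.left] [IrreducibleSpace S₀.left] (hdim : topologicalKrullDim S₀.left ≤ 1) :
    {s : ComplexPoints ((baseChangeHom σ).obj S₀) |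
      (baseChangeHomFst σ S₀).base s.pt ≠ genericPoint S₀.left}.Countable := by
  haveI : Countable S₀.left := countable_of_locallyOfFiniteType S₀.hom
  have hsub : {s : ComplexPoints ((baseChangeHom σ).obj S₀) |
      (baseChangeHomFst σ S₀).base s.pt ≠ genericPoint S₀.left} ⊆
      ⋃ x : {x : S₀.left // x ≠ genericPoint S₀.left},
        {s : ComplexPoints ((baseChangeHom σ).obj S₀) |
          (baseChangeHomFst σ S₀).base s.pt = x.1} := by
    intro s hs
    exact Set.mem_iUnion.2 ⟨⟨_, hs⟩, rfl⟩
  refine (Set.countable_iUnion fun x => ?_).mono hsub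
  exact (finite_setOf_base_pt_eq σ S₀ (isClosed_singleton_of_ne_genericPoint hdim x.2)).countable

/-- **Weil's form: the non-`K`-generic complex points are countable.** For `K` countable and `S₀`
quasi-compact, irreducible, locally of finite type of dimension `≤ 1`, the complex points `s` of
`S₀ ⊗_σ ℂ` which lie in some PROPER subset defined over `σ(K)` (`IsDefinedOver σ S₀ σ.fieldRange`) —
i.e. which are not `K`-generic in the sense of the crux line `padic-disc-transport` — form a countable
set (`weilGeneric_fieldRange_iff_base_pt_eq_genericPoint`). [cite: Lang1958IAG, Ch. III §5, C4–C7]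
[cite: MaulikPoonen2012, §4] -/
theorem countable_setOf_not_weilGeneric [Countable K] [LocallyOfFiniteType S₀.hom]
    [CompactSpace S₀.left] [IrreducibleSpace S₀.left] (hdim : topologicalKrullDim S₀.left ≤ 1) :
    {s : ComplexPoints ((baseChangeHom σ).obj S₀) |
      ¬ ∀ Z : Set (ComplexPoints ((baseChangeHom σ).obj S₀)),
        IsDefinedOver σ S₀ σ.fieldRange Z → s ∈ Z → Z = Set.univ}.Countable := by
  refine (countable_setOf_base_pt_ne_genericPoint σ S₀ hdim).mono fun s hs => ?_
  intro h
  exact hs ((weilGeneric_fieldRange_iff_base_pt_eq_genericPoint (σ := σ) (S₀ := S₀) s).2 h)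

/-- **An uncountable set of complex points of a curve over a countable field contains a `K`-generic
point** (the counting step of the `p`-adic residue-disc argument: Maulik–Poonen 2012, §4 — a residue
disc is uncountable, `K̄` is countable). [cite: MaulikPoonen2012, §4] -/
theorem exists_weilGeneric_of_not_countable [Countable K] [LocallyOfFiniteType S₀.hom]
    [CompactSpace S₀.left] [IrreducibleSpace S₀.left] (hdim : topologicalKrullDim S₀.left ≤ 1)
    {G : Set (ComplexPoints ((baseChangeHom σ).obj S₀))} (hG : ¬ G.Countable) :
    ∃ s ∈ G, ∀ Z : Set (ComplexPoints ((baseChangeHom σ).obj S₀)),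
      IsDefinedOver σ S₀ σ.fieldRange Z → s ∈ Z → Z = Set.univ := by
  by_contra h
  push Not at h
  apply hG
  refine (countable_setOf_not_weilGeneric σ S₀ hdim).mono fun s hs => ?_
  obtain ⟨Z, hZ, hsZ, hne⟩ := h s hs
  intro hall
  exact hne (hall Z hZ hsZ)

end Countable

/-! ## The hypotheses carried by the complexification (shape of the crux) -/

section Complexification

variable {K : Type} [Field K] (σ : K →+* ℂ) (S₀ : SchemeOver K)

/-- The defining cartesian square of `S₀ ⊗_σ ℂ`. [folklore] -/
private theorem isPullback_baseChangeHomFst_hom :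
    IsPullback (baseChangeHomFst σ S₀) ((baseChangeHom σ).obj S₀).hom S₀.hom
      (Spec.map (CommRingCat.ofHom σ)) :=
  IsPullback.of_hasPullback S₀.hom (Spec.map (CommRingCat.ofHom σ))

/-- `Spec ℂ → Spec K` is an fpqc cover (surjective, flat, quasi-compact). [folklore] -/
private theorem surjective_flat_quasiCompact_specMap :
    (@Surjective ⊓ @Flat ⊓ @QuasiCompact : MorphismProperty Scheme)
      (Spec.map (CommRingCat.ofHom σ)) := by
  letI := σ.toAlgebra
  haveI : Subsingleton ↥(Spec (CommRingCat.of K)) :=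
    inferInstanceAs (Subsingleton (PrimeSpectrum K))
  haveI h1 : Surjective (Spec.map (CommRingCat.ofHom σ)) :=
    ⟨fun x ↦ ⟨(default : ↥(Spec (CommRingCat.of ℂ))), Subsingleton.elim _ _⟩⟩
  haveI h2 : Flat (Spec.map (CommRingCat.ofHom σ)) := by
    rw [HasRingHomProperty.Spec_iff (P := @Flat)]
    change Module.Flat K ℂ
    infer_instance
  have h3 : QuasiCompact (Spec.map (CommRingCat.ofHom σ)) := inferInstance
  exact ⟨⟨h1, h2⟩, h3⟩

/-- `S₀` is locally of finite type over `K` if its complexification is locally of finite type over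
`ℂ` (fpqc descent along `Spec ℂ → Spec K`). [cite: GrothendieckDieudonne1965, Prop. 2.7.1 (iv)] -/
theorem locallyOfFiniteType_of_complexification
    [LocallyOfFiniteType ((baseChangeHom σ).obj S₀).hom] : LocallyOfFiniteType S₀.hom :=
  MorphismProperty.of_isPullback_of_descendsAlong (P := @LocallyOfFiniteType)
    (Q := @Surjective ⊓ @Flat ⊓ @QuasiCompact) (isPullback_baseChangeHomFst_hom σ S₀).flip
    (surjective_flat_quasiCompact_specMap σ) ‹_›

/-- `S₀` is quasi-compact if its complexification is (the projection `S₀ ⊗_σ ℂ → S₀` is a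
continuous surjection). [folklore] -/
private theorem compactSpace_of_complexification [CompactSpace ((baseChangeHom σ).obj S₀).left] :
    CompactSpace S₀.left := by
  haveI : Surjective (baseChangeHomFst σ S₀) :=
    MorphismProperty.pullback_fst (P := @Surjective) _ _ (surjective_flat_quasiCompact_specMap σ).1.1
  refine ⟨?_⟩
  rw [← Set.image_univ_of_surjective (baseChangeHomFst σ S₀).surjective]
  exact isCompact_univ.image (baseChangeHomFst σ S₀).continuous

/-- `S₀` is irreducible if its complexification is. [folklore] -/
private theorem irreducibleSpace_of_complexification [IrreducibleSpace ((baseChangeHom σ).obj S₀).left] :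
    IrreducibleSpace S₀.left := by
  haveI : Surjective (baseChangeHomFst σ S₀) :=
    MorphismProperty.pullback_fst (P := @Surjective) _ _ (surjective_flat_quasiCompact_specMap σ).1.1
  exact (baseChangeHomFst σ S₀).surjective.irreducibleSpace (baseChangeHomFst σ S₀).continuous

/-- `dim (S₀ ⊗_σ ℂ) = dim S₀` (`S₀` locally of finite type; the tree's
`topologicalKrullDim_eq_of_isPullback`, Görtz–Wedhorn I, Prop. 5.38). [cite: GortzWedhorn2020, Prop. 5.38] -/
theorem topologicalKrullDim_complexification [LocallyOfFiniteType S₀.hom] :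
    topologicalKrullDim ((baseChangeHom σ).obj S₀).left = topologicalKrullDim S₀.left :=
  topologicalKrullDim_eq_of_isPullback σ S₀.hom (baseChangeHomFst σ S₀)
    ((baseChangeHom σ).obj S₀).hom (isPullback_baseChangeHomFst_hom σ S₀)

/-- **The counting lemma in the shape of the crux line `padic-disc-transport`.** Let `K` be a
countable field, `σ : K →+* ℂ`, and `S₀` a `K`-scheme whose complexification `S = S₀ ⊗_σ ℂ` is
affine, irreducible, locally of finite type and one-dimensional (e.g. the base of the descended crux
data: a smooth irreducible affine curve). Then the complex points of `S` that are NOT `K`-generic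
(`PadicDiscTransport.IsGenericPoint K σ s`, unfolded) form a countable set. [cite: MaulikPoonen2012, §4]
[cite: CharlesSchnell2014Notes, Lemma 11.3.14] -/
theorem countable_setOf_not_weilGeneric_of_complexification [Countable K]
    [IsAffine ((baseChangeHom σ).obj S₀).left] [IrreducibleSpace ((baseChangeHom σ).obj S₀).left]
    [LocallyOfFiniteType ((baseChangeHom σ).obj S₀).hom]
    (hdim : topologicalKrullDim ((baseChangeHom σ).obj S₀).left ≤ 1) :
    {s : ComplexPoints ((baseChangeHom σ).obj S₀) |
      ¬ ∀ Z : Set (ComplexPoints ((baseChangeHom σ).obj S₀)),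
        IsDefinedOver σ S₀ σ.fieldRange Z → s ∈ Z → Z = Set.univ}.Countable := by
  haveI : LocallyOfFiniteType S₀.hom := locallyOfFiniteType_of_complexification σ S₀
  haveI : CompactSpace S₀.left := compactSpace_of_complexification σ S₀
  haveI : IrreducibleSpace S₀.left := irreducibleSpace_of_complexification σ S₀
  have hdim₀ : topologicalKrullDim S₀.left ≤ 1 := by
    rw [← topologicalKrullDim_complexification σ S₀]; exact hdim
  exact countable_setOf_not_weilGeneric σ S₀ hdim₀

/-- **An uncountable set of complex points of the curve contains a `K`-generic point**, hypotheses
on the complexification as in the crux line `padic-disc-transport`. [cite: MaulikPoonen2012, §4] -/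
theorem exists_weilGeneric_of_not_countable_of_complexification [Countable K]
    [IsAffine ((baseChangeHom σ).obj S₀).left] [IrreducibleSpace ((baseChangeHom σ).obj S₀).left]
    [LocallyOfFiniteType ((baseChangeHom σ).obj S₀).hom]
    (hdim : topologicalKrullDim ((baseChangeHom σ).obj S₀).left ≤ 1)
    {G : Set (ComplexPoints ((baseChangeHom σ).obj S₀))} (hG : ¬ G.Countable) :
    ∃ s ∈ G, ∀ Z : Set (ComplexPoints ((baseChangeHom σ).obj S₀)),
      IsDefinedOver σ S₀ σ.fieldRange Z → s ∈ Z → Z = Set.univ := by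
  by_contra h
  push Not at h
  apply hG
  refine (countable_setOf_not_weilGeneric_of_complexification σ S₀ hdim).mono fun s hs => ?_
  obtain ⟨Z, hZ, hsZ, hne⟩ := h s hs
  intro hall
  exact hne (hall Z hZ hsZ)

end Complexification

end Literature.AlgebraicGeometry.HodgeTheory

end
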